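import Summits.SmoothPoincare4.SmoothPoincare4.Theorems.ConvexBisectionAcyclicBisectionExistsCrossingCountLocal
import HarnessLib

/-!
# Counting crossings, II: the crossing number at a regular level is the sum of the signs
(wave 5, brick X7-1b = the counting step (iv) of the symmetry statement (R1)
`crossingNumber_symm` for the missing lemma `crossingNumber_eq_stdSymp` of node N1a of stub
`stub_modelsOnFibred_of_reach` = NF4, line `modp-braid-orbits`, crux
`ConvexBisection.AcyclicBisectionExists`, item stmt-SmoothPoincare4-10508; registered sub-goal
`helper_crossingNumber_eq_sum_sign`)

Z6-REPORT §3 (R1)(iv) COUNTING, in the form suggested there: let `φ` be an annulus chart of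
`page g c` (continuous, `1`-periodic, in the page, injective on `[0,1) × (−1,1)`), `K` a loop of
the page, `f u = height φ (K e^{2πiu})` its transverse coordinate and `k` a level (`|k| < 1/2`)
whose solutions `u ∈ [0, 1]` (inside the open annulus) form a finite set `S ⊂ (0, 1)` at each point
of which `f` is `C¹` with `f' ≠ 0`.  Then

  **`crossingNumber φ K = Σ_{u ∈ S} sign (f' u)`**  (`crossingNumber_eq_sum_sign`).

Proof: around each `u ∈ S` a common small radius `ρ` (`f` continuous and strictly monotone on
`[u − ρ, u + ρ] ⊂ (0, 1)`, the loop inside the annulus there, the intervals pairwise separated —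
`exists_Icc_deriv_sign`, `exists_pos_le_finset`); off these open intervals a uniform level gap
`η` (`exists_level_gap`); then in the re-profiled chart `φ_{k,η}` (same crossing number,
`crossingNumber_reprofile`, Z6-5) the loop makes one clean passage of sign `sign (f' u)` near
each `u` (`exists_clean_passage`) and is off the collar elsewhere, so the passage formula
`crossingNumber_eq_sum_passages` (Z6-8), read over `S` in increasing order
(`Finset.orderEmbOfFin`), gives the sum of the signs.
Everything is proved; no definitions, no named facts, no `sorry`.  References: W. Fulton,
*Algebraic Topology: A First Course* (1995), §3 [Fulton1995]; B. Farb, D. Margalit, *A primer on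
mapping class groups* (2012), §6.1 [FarbMargalit2012].
-/

noncomputable section

set_option linter.dupNamespace false

open scoped Manifold ContDiff Topology Real
open Set Function Metric Filter
open Literature.Topology.FourManifolds Literature.Topology.FourManifolds.LefschetzBase

namespace Summit.SmoothPoincare4.SmoothPoincare4.Theorems.AcyclicBisectionExists.ModpBraidOrbits

variable {g : ℕ} {c : ℂ} {φ : ℝ × ℝ → Base g} {K : sphere (0 : EuclideanSpace ℝ (Fin 2)) 1 → Base g}

/-! ## §1 Finite sets of reals: separation, sums in increasing order -/

/-- **Finitely many reals are uniformly separated.** [folklore] -/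
theorem exists_pos_le_abs_sub_finset (S : Finset ℝ) :
    ∃ d > 0, ∀ u ∈ S, ∀ u' ∈ S, u ≠ u' → d ≤ |u - u'| := by
  obtain ⟨d, hd, hdS⟩ := exists_pos_le_finset S.offDiag (r := fun p : ℝ × ℝ => |p.1 - p.2|)
    fun p hp => by
      obtain ⟨-, -, hne⟩ := Finset.mem_offDiag.1 hp
      exact abs_pos.2 (sub_ne_zero.2 hne)
  exact ⟨d, hd, fun u hu u' hu' hne => hdS (u, u') (Finset.mem_offDiag.2 ⟨hu, hu', hne⟩)⟩

/-- **A sum over a finite set of reals, read in increasing order.** [folklore] -/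
theorem sum_range_orderEmbOfFin (S : Finset ℝ) (F : ℝ → ℤ) {e : ℕ → ℝ}
    (he : ∀ (i : ℕ) (hi : i < S.card), e i = S.orderEmbOfFin rfl ⟨i, hi⟩) :
    ∑ i ∈ Finset.range S.card, F (e i) = ∑ u ∈ S, F u := by
  rw [← Fin.sum_univ_eq_sum_range (fun i => F (e i)) S.card]
  have h1 : ∑ i : Fin S.card, F (e i) = ∑ i : Fin S.card, F (S.orderEmbOfFin rfl i) :=
    Finset.sum_congr rfl fun i _ => by rw [he i i.2]
  have h2 : (Finset.univ.map (S.orderEmbOfFin rfl).toEmbedding) = S := by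
    apply Finset.coe_injective
    rw [Finset.coe_map, Finset.coe_univ, Set.image_univ]
    exact S.range_orderEmbOfFin rfl
  rw [h1]
  conv_rhs => rw [← h2]
  rw [Finset.sum_map]
  rfl

/-- A point of the closed collar of the re-profiled chart `φ_{k,η}` lies in the strip
`φ(ℝ × [k − η, k + η])`. [folklore] -/
theorem mem_strip_of_mem_collar_reprofile (hφ1 : ∀ u r, φ (u + 1, r) = φ (u, r))
    (hφi : InjOn φ (Ico (0 : ℝ) 1 ×ˢ Ioo (-1 : ℝ) 1)) {k η : ℝ} (hη : 0 < η) (hkη : |k| + η ≤ 1)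
    {q : Base g}
    (hq : q ∈ (fun p : ℝ × ℝ => φ (p.1, k + η * p.2)) '' (univ ×ˢ Icc (-(1 / 2) : ℝ) (1 / 2))) :
    q ∈ φ '' (univ ×ˢ Icc (k - η) (k + η)) := by
  obtain ⟨hA, hle⟩ := height_of_mem_collar_reprofile hφ1 hφi hη hkη hq
  obtain ⟨-, hq'⟩ := prelift_spec hA
  have h := abs_le.1 hle
  have e : height φ q = (prelift φ q).2 := rfl
  rw [e] at h
  exact ⟨prelift φ q, ⟨trivial, by linarith [h.1], by linarith [h.2]⟩, hq'⟩

/-! ## §2 The counting theorem -/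

/-- **Counting: the crossing number at a regular level is the sum of the signs of the
crossings** ((R1)(iv) of Z6 §3).  For an annulus chart `φ` of `page g c`, a loop `K` of the page
and a level `|k| < 1/2` whose solutions `u ∈ [0, 1]` of `height φ (K e^{2πiu}) = k` inside the
open annulus form a finite set `S ⊂ (0, 1)` of `C¹` points with non-zero derivative,
`crossingNumber φ K = Σ_{u ∈ S} sign (d/du height φ (K e^{2πiu}))`. [cite: Fulton1995, §3] -/
theorem crossingNumber_eq_sum_sign (hc : ‖c‖ = 1) (hφc : Continuous φ)
    (hφ1 : ∀ u r, φ (u + 1, r) = φ (u, r)) (hφp : ∀ p, φ p ∈ page g c)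
    (hφi : InjOn φ (Ico (0 : ℝ) 1 ×ˢ Ioo (-1 : ℝ) 1)) (hK : Continuous K)
    (hKc : ∀ θ, K θ ∈ page g c) {k : ℝ} (hk : k ∈ Ioo (-(1 / 2) : ℝ) (1 / 2)) (S : Finset ℝ)
    (hS : ∀ u ∈ S, u ∈ Ioo (0 : ℝ) 1)
    (hlev : ∀ u ∈ Icc (0 : ℝ) 1,
      (K (circlePt u) ∈ φ '' (univ ×ˢ Ioo (-1 : ℝ) 1) ∧ height φ (K (circlePt u)) = k) ↔ u ∈ S)
    (hreg : ∀ u ∈ S, ContDiffAt ℝ 1 (fun u => height φ (K (circlePt u))) u ∧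
      deriv (fun u => height φ (K (circlePt u))) u ≠ 0) :
    crossingNumber φ K =
      ∑ u ∈ S, if 0 < deriv (fun u => height φ (K (circlePt u))) u then (1 : ℤ) else -1 := by
  classical
  set f : ℝ → ℝ := fun u => height φ (K (circlePt u)) with hf
  have hkη1 : |k| < 1 / 2 := abs_lt.2 ⟨hk.1, hk.2⟩
  have hL : Continuous fun t : ℝ => K (circlePt t) := hK.comp continuous_circlePt
  have hUo : IsOpen ((fun t : ℝ => K (circlePt t)) ⁻¹' (φ '' (univ ×ˢ Ioo (-1 : ℝ) 1))) :=
    isOpen_preimage_annulus hc hφc hφ1 hφp hφi hL fun t => hKc _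
  have hSk : ∀ u ∈ S, K (circlePt u) ∈ φ '' (univ ×ˢ Ioo (-1 : ℝ) 1) ∧ f u = k := fun u hu =>
    (hlev u ⟨(hS u hu).1.le, (hS u hu).2.le⟩).2 hu
  -- Step 1: a radius for each solution, then a common one, separating the solutions
  have hrad : ∀ u ∈ S, ∃ ρ > 0, Icc (u - ρ) (u + ρ) ⊆ Ioo (0 : ℝ) 1 ∧
      (∀ t ∈ Icc (u - ρ) (u + ρ), K (circlePt t) ∈ φ '' (univ ×ˢ Ioo (-1 : ℝ) 1)) ∧
      ContinuousOn f (Icc (u - ρ) (u + ρ)) ∧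
      ∀ y ∈ Icc (u - ρ) (u + ρ), 0 < deriv f u * deriv f y := by
    intro u hu
    obtain ⟨ρ₁, hρ₁, hcont, hsign⟩ := exists_Icc_deriv_sign (hreg u hu).1 (hreg u hu).2
    have hN : Ioo (0 : ℝ) 1 ∩ (fun t : ℝ => K (circlePt t)) ⁻¹' (φ '' (univ ×ˢ Ioo (-1 : ℝ) 1)) ∈
        𝓝 u := (isOpen_Ioo.inter hUo).mem_nhds ⟨hS u hu, (hSk u hu).1⟩
    obtain ⟨ε, hε, hball⟩ := Metric.mem_nhds_iff.1 hN
    have hm1 : min ρ₁ (ε / 2) ≤ ρ₁ := min_le_left _ _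
    have hm2 : min ρ₁ (ε / 2) ≤ ε / 2 := min_le_right _ _
    have hsub : Icc (u - min ρ₁ (ε / 2)) (u + min ρ₁ (ε / 2)) ⊆ Icc (u - ρ₁) (u + ρ₁) :=
      Icc_subset_Icc (by linarith) (by linarith)
    have hsub' : ∀ t ∈ Icc (u - min ρ₁ (ε / 2)) (u + min ρ₁ (ε / 2)), t ∈ ball u ε := fun t ht => by
      rw [Real.ball_eq_Ioo]; exact ⟨by linarith [ht.1], by linarith [ht.2]⟩
    exact ⟨min ρ₁ (ε / 2), lt_min hρ₁ (by linarith), fun t ht => (hball (hsub' t ht)).1,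
      fun t ht => (hball (hsub' t ht)).2, hcont.mono hsub, fun y hy => hsign y (hsub hy)⟩
  choose! ρf hρf hρI hρA hρc hρs using hrad
  obtain ⟨ρ₀, hρ₀, hρ₀le⟩ := exists_pos_le_finset S hρf
  obtain ⟨d, hd, hdS⟩ := exists_pos_le_abs_sub_finset S
  obtain ⟨ρ, hρ, hρle, hρd⟩ : ∃ ρ, 0 < ρ ∧ (∀ u ∈ S, ρ ≤ ρf u) ∧ 3 * ρ ≤ d :=
    ⟨min ρ₀ (d / 3), lt_min hρ₀ (by linarith), fun u hu => (min_le_left _ _).trans (hρ₀le u hu),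
      by linarith [min_le_right ρ₀ (d / 3)]⟩
  have hIsub : ∀ u ∈ S, Icc (u - ρ) (u + ρ) ⊆ Icc (u - ρf u) (u + ρf u) := fun u hu =>
    Icc_subset_Icc (by linarith [hρle u hu]) (by linarith [hρle u hu])
  have hsep : ∀ u ∈ S, ∀ u' ∈ S, u < u' → u + ρ < u' - ρ := by
    intro u hu u' hu' hlt
    have h := hdS u hu u' hu' hlt.ne
    rw [abs_of_neg (by linarith)] at h
    linarith
  have hI01 : ∀ u ∈ S, Icc (u - ρ) (u + ρ) ⊆ Ioo (0 : ℝ) 1 := fun u hu =>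
    (hIsub u hu).trans (hρI u hu)
  have hIA : ∀ u ∈ S, ∀ t ∈ Icc (u - ρ) (u + ρ), K (circlePt t) ∈ φ '' (univ ×ˢ Ioo (-1 : ℝ) 1) :=
    fun u hu t ht => hρA u hu t (hIsub u hu ht)
  -- Step 2: the level gap off the intervals
  set T : Set ℝ := Icc (0 : ℝ) 1 \ ⋃ u ∈ S, Ioo (u - ρ) (u + ρ) with hT
  have hTc : IsCompact T := isCompact_Icc.diff (isOpen_biUnion fun u _ => isOpen_Ioo)
  have hTk : ∀ t ∈ T, K (circlePt t) ∈ φ '' (univ ×ˢ Ioo (-1 : ℝ) 1) → f t ≠ k := by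
    rintro t ⟨htI, htU⟩ htA hft
    exact htU (mem_iUnion₂.2 ⟨t, (hlev t htI).1 ⟨htA, hft⟩, by linarith, by linarith⟩)
  obtain ⟨η, hη, hη4, hgap⟩ := exists_level_gap hc hφc hφ1 hφp hφi hK hKc hk hTc hTk
  have hkη : |k| + η ≤ 1 := by linarith
  have hmemT : ∀ t ∈ Icc (0 : ℝ) 1, (∀ u ∈ S, t ∉ Ioo (u - ρ) (u + ρ)) → t ∈ T := fun t ht h =>
    ⟨ht, fun hU => by
      obtain ⟨u, hu, htu⟩ := mem_iUnion₂.1 hU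
      exact h u hu htu⟩
  have hnotIoo : ∀ u ∈ S, ∀ u' ∈ S, u - ρ ∉ Ioo (u' - ρ) (u' + ρ) ∧ u + ρ ∉ Ioo (u' - ρ) (u' + ρ) := by
    intro u hu u' hu'
    rcases lt_trichotomy u u' with hlt | rfl | hgt
    · have h := hsep u hu u' hu' hlt
      exact ⟨fun hm => by linarith [hm.1], fun hm => by linarith [hm.1]⟩
    · exact ⟨fun hm => by linarith [hm.1], fun hm => by linarith [hm.2]⟩
    · have h := hsep u' hu' u hu hgt
      exact ⟨fun hm => by linarith [hm.2], fun hm => by linarith [hm.2]⟩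
  have hendT : ∀ u ∈ S, u - ρ ∈ T ∧ u + ρ ∈ T := fun u hu =>
    ⟨hmemT _ (Ioo_subset_Icc_self (hI01 u hu ⟨le_rfl, by linarith⟩))
        fun u' hu' => (hnotIoo u hu u' hu').1,
      hmemT _ (Ioo_subset_Icc_self (hI01 u hu ⟨by linarith, le_rfl⟩))
        fun u' hu' => (hnotIoo u hu u' hu').2⟩
  -- Step 3: one clean passage near each solution, in the re-profiled chart `φ_{k,η}`
  have hpass : ∀ u ∈ S, ∃ s t, u - ρ ≤ s ∧ s < t ∧ t ≤ u + ρ ∧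
      (∀ τ ∈ Icc s t, K (circlePt τ) ∈
        (fun p : ℝ × ℝ => φ (p.1, k + η * p.2)) '' (univ ×ˢ Ioo (-1 : ℝ) 1)) ∧
      (∀ τ ∈ Icc (u - ρ) (u + ρ), τ ∉ Ioo s t → K (circlePt τ) ∉
        (fun p : ℝ × ℝ => φ (p.1, k + η * p.2)) '' (univ ×ˢ Icc (-(1 / 2) : ℝ) (1 / 2))) ∧
      outerInd (fun p : ℝ × ℝ => φ (p.1, k + η * p.2)) (K (circlePt t)) -
        outerInd (fun p : ℝ × ℝ => φ (p.1, k + η * p.2)) (K (circlePt s)) =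
        (if 0 < deriv f u then (1 : ℤ) else -1) := by
    intro u hu
    have hcont : ContinuousOn f (Icc (u - ρ) (u + ρ)) := (hρc u hu).mono (hIsub u hu)
    have hsign : ∀ y ∈ Icc (u - ρ) (u + ρ), 0 < deriv f u * deriv f y := fun y hy =>
      hρs u hu y (hIsub u hu hy)
    by_cases hpos : 0 < deriv f u
    · rw [if_pos hpos]
      have hmono : StrictMonoOn f (Icc (u - ρ) (u + ρ)) :=
        strictMonoOn_of_deriv_pos (convex_Icc _ _) hcont fun y hy =>
          pos_of_mul_pos_right (hsign y (interior_subset hy)) hpos.le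
      refine exists_clean_passage hφ1 hφi hk hη hη4 hρ (Or.inl rfl) (hIA u hu) ?_ ?_ (hSk u hu).2
        (hgap _ (hendT u hu).1) (hgap _ (hendT u hu).2)
      · exact continuousOn_const.mul (hcont.sub continuousOn_const)
      · intro a ha b hb hab
        have h := hmono ha hb hab
        show ((1 : ℤ) : ℝ) * (f a - k) < ((1 : ℤ) : ℝ) * (f b - k)
        push_cast
        linarith
    · rw [if_neg hpos]
      have hneg : deriv f u < 0 := lt_of_le_of_ne (not_lt.1 hpos) (hreg u hu).2
      have hanti : StrictAntiOn f (Icc (u - ρ) (u + ρ)) :=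
        strictAntiOn_of_deriv_neg (convex_Icc _ _) hcont fun y hy => by
          nlinarith [hsign y (interior_subset hy)]
      refine exists_clean_passage hφ1 hφi hk hη hη4 hρ (Or.inr rfl) (hIA u hu) ?_ ?_ (hSk u hu).2
        (hgap _ (hendT u hu).1) (hgap _ (hendT u hu).2)
      · exact continuousOn_const.mul (hcont.sub continuousOn_const)
      · intro a ha b hb hab
        have h := hanti ha hb hab
        show ((-1 : ℤ) : ℝ) * (f a - k) < ((-1 : ℤ) : ℝ) * (f b - k)
        push_cast
        linarith
  choose! sL tR hsl hst htr hin hout hnet using hpass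
  -- Step 4: the passages in increasing order
  set n := S.card with hn
  obtain ⟨E, hE⟩ : ∃ E : ℕ → ℝ, ∀ (i : ℕ) (h : i < n), E i = S.orderEmbOfFin rfl ⟨i, h⟩ :=
    ⟨fun i => if h : i < n then S.orderEmbOfFin rfl ⟨i, h⟩ else 0, fun i h => dif_pos h⟩
  have hEmem : ∀ i < n, E i ∈ S := fun i hi => by
    rw [hE i hi]; exact S.orderEmbOfFin_mem rfl _
  have hElt : ∀ i j, i < j → j < n → E i < E j := fun i j hij hj => by
    rw [hE i (hij.trans hj), hE j hj]
    exact (S.orderEmbOfFin rfl).strictMono (Fin.mk_lt_mk.2 hij)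
  have hEsurj : ∀ u ∈ S, ∃ i < n, E i = u := fun u hu => by
    have h : u ∈ Set.range (S.orderEmbOfFin rfl) := by rw [Finset.range_orderEmbOfFin]; exact hu
    obtain ⟨i, hi⟩ := h
    exact ⟨i, i.2, by rw [hE i i.2]; exact hi⟩
  obtain ⟨sN, hsN', hsN0⟩ : ∃ sN : ℕ → ℝ, (∀ i < n, sN i = sL (E i)) ∧ ∀ i, ¬ i < n → sN i = 1 :=
    ⟨fun i => if i < n then sL (E i) else 1, fun i hi => if_pos hi, fun i hi => if_neg hi⟩
  obtain ⟨tN, htN'⟩ : ∃ tN : ℕ → ℝ, ∀ i < n, tN i = tR (E i) := ⟨fun i => tR (E i), fun i _ => rfl⟩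
  have hφ'c : Continuous fun p : ℝ × ℝ => φ (p.1, k + η * p.2) :=
    hφc.comp (continuous_fst.prodMk (continuous_const.add (continuous_const.mul continuous_snd)))
  have hcount := crossingNumber_eq_sum_passages hc hφ'c (reprofile_periodic hφ1 k η)
    (reprofile_mem_page hφp k η) (reprofile_injOn hφi hη hkη) hK hKc (n := n) sN tN ?_ ?_ ?_ ?_ ?_ ?_
  · rw [crossingNumber_reprofile hc hφc hφ1 hφp hφi hK hKc hη hkη] at hcount
    rw [hcount]
    have key : ∀ i ∈ Finset.range n,
        outerInd (fun p : ℝ × ℝ => φ (p.1, k + η * p.2)) (K (circlePt (tN i))) -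
          outerInd (fun p : ℝ × ℝ => φ (p.1, k + η * p.2)) (K (circlePt (sN i))) =
        (if 0 < deriv f (E i) then (1 : ℤ) else -1) := fun i hi => by
      rw [Finset.mem_range] at hi
      rw [hsN' i hi, htN' i hi]
      exact hnet (E i) (hEmem i hi)
    rw [Finset.sum_congr rfl key]
    exact sum_range_orderEmbOfFin S (fun u => if 0 < deriv f u then (1 : ℤ) else -1) hE
  · -- `0 ≤ s 0`
    by_cases h0 : 0 < n
    · rw [hsN' 0 h0]
      have h1 := (hI01 _ (hEmem 0 h0) ⟨le_rfl, by linarith⟩).1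
      linarith [hsl _ (hEmem 0 h0)]
    · rw [hsN0 0 h0]; exact zero_le_one
  · intro i hi
    rw [hsN' i hi, htN' i hi]
    exact (hst _ (hEmem i hi)).le
  · intro i hi
    rw [htN' i (by omega), hsN' (i + 1) hi]
    have h := hsep _ (hEmem i (by omega)) _ (hEmem (i + 1) hi) (hElt i (i + 1) (by omega) hi)
    linarith [htr _ (hEmem i (by omega)), hsl _ (hEmem (i + 1) hi)]
  · intro i hi
    rw [htN' i hi]
    have h1 := (hI01 _ (hEmem i hi) ⟨by linarith, le_rfl⟩).2
    linarith [htr _ (hEmem i hi)]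
  · intro i hi τ hτ
    rw [hsN' i hi, htN' i hi] at hτ
    exact hin _ (hEmem i hi) τ hτ
  · intro τ hτ hτout hmem
    by_cases hnear : ∃ u ∈ S, τ ∈ Icc (u - ρ) (u + ρ)
    · obtain ⟨u, hu, hτu⟩ := hnear
      obtain ⟨i, hi, rfl⟩ := hEsurj u hu
      have h := hτout i hi
      rw [hsN' i hi, htN' i hi] at h
      exact hout _ hu τ hτu h hmem
    · push Not at hnear
      have hτT : τ ∈ T := hmemT τ hτ fun u hu hm => hnear u hu (Ioo_subset_Icc_self hm)
      exact hgap τ hτT (mem_strip_of_mem_collar_reprofile hφ1 hφi hη hkη hmem)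

/-! ## §3 The registered form -/

/-- **Sub-goal `helper_crossingNumber_eq_sum_sign`** (X7-1b = (R1)(iv) COUNTING, a step of the
symmetry statement for node N1a of NF4): the crossing number of a page loop with an annulus chart,
counted at a regular level `|k| < 1/2` of the transverse coordinate with finitely many transversal
`C¹` solutions in `(0, 1)`, is the sum of the signs of the derivative at the solutions.
[cite: Fulton1995, §3] -/
theorem helper_crossingNumber_eq_sum_sign : ∀ (g : ℕ) (c : ℂ) (_hc : ‖c‖ = 1) (φ : ℝ × ℝ → Literature.Topology.FourManifolds.LefschetzBase.Base g) (_hφc : Continuous φ) (_hφ1 : ∀ u r, φ (u + 1, r) = φ (u, r)) (_hφp : ∀ p, φ p ∈ Literature.Topology.FourManifolds.LefschetzBase.page g c) (_hφi : Set.InjOn φ (Set.Ico (0 : ℝ) 1 ×ˢ Set.Ioo (-1 : ℝ) 1)) (K : Metric.sphere (0 : EuclideanSpace ℝ (Fin 2)) 1 → Literature.Topology.FourManifolds.LefschetzBase.Base g) (_hK : Continuous K) (_hKc : ∀ θ, K θ ∈ Literature.Topology.FourManifolds.LefschetzBase.page g c) (k : ℝ) (_hk : k ∈ Set.Ioo (-(1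 / 2) : ℝ) (1 / 2)) (S : Finset ℝ), (∀ u ∈ S, u ∈ Set.Ioo (0 : ℝ) 1) → (∀ u ∈ Set.Icc (0 : ℝ) 1, (K (Literature.Topology.FourManifolds.circlePt u) ∈ φ '' (Set.univ ×ˢ Set.Ioo (-1 : ℝ) 1) ∧ Summit.SmoothPoincare4.SmoothPoincare4.Theorems.AcyclicBisectionExists.ModpBraidOrbits.height φ (K (Literature.Topology.FourManifolds.circlePt u)) = k) ↔ u ∈ S) → (∀ u ∈ S, ContDiffAt ℝ 1 (fun u => Summit.SmoothPoincare4.SmoothPoincare4.Theorems.AcyclicBisectionExists.ModpBraidOrbits.height φ (K (Literature.Topology.FourManifolds.circlePt u))) u ∧ deriv (fun u => Summit.SmoothPoincare4.SmoothPoincare4.Theorems.AcyclicBisectionExists.ModpBraidOrbits.height φ (K (Literature.Topology.FourManifolds.circlePt u))) u ≠ 0) → Summit.SmoothPoincare4.SmoothPoincare4.Theorems.AcyclicBisectionExists.ModpBraidOrbits.crossingNumber φ K = ∑ u ∈ S, if 0 < deriv (fun u => Summit.SmoothPoincare4.SmoothPoincare4.Theorems.AcyclicBisectionExists.ModpBraidOrbits.height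 φ (K (Literature.Topology.FourManifolds.circlePt u))) u then (1 : ℤ) else -1 :=
  fun _ _ hc _ hφc hφ1 hφp hφi _ hK hKc _ hk S hS hlev hreg =>
    crossingNumber_eq_sum_sign hc hφc hφ1 hφp hφi hK hKc hk S hS hlev hreg

end Summit.SmoothPoincare4.SmoothPoincare4.Theorems.AcyclicBisectionExists.ModpBraidOrbits

end
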